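import Literature.Geometry.Lorentzian.GaussEquationFrame
import Literature.Geometry.Lorentzian.LeviCivitaCovDerivProofs
import HarnessLib

/-!
# The Codazzi equation of an immersed hypersurface, on a coordinate triple

O'Neill 1983, Ch. 4, Prop. 33 (p. 115), the **Codazzi equation**: for a semi-Riemannian
submanifold `M ⊂ M̄` with shape tensor `II`, normal connection `∇^⊥` and `V, W, X` tangent to `M`,
`nor R̄_{VW} X = −(∇_V II)(W, X) + (∇_W II)(V, X)` (in O'Neill's sign `R̄_{VW} = −R̄(V, W)`). For a
hypersurface with a unit normal field `ν` of sign `ε` and the scalar second fundamental form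
`K(v, w) = g(D_v ν, df w)` of the tree (`secondFundamentalForm`, so `II(v, w) = −ε K(v, w) ν` and
`∇^⊥ ν = 0`), and in the curvature convention of this directory
(`R(X, Y) = ∇_X ∇_Y − ∇_Y ∇_X − ∇_{[X,Y]}`), it reads

  `(∇_V K)(W, X) − (∇_W K)(V, X) = g(R̄(df V, df W) ν, df X)`,

with `∇K` the covariant differential of `K` for the Levi-Civita connection of the induced metric
`f^*g` (the tree's `covDeriv₂`, derivative slot last: `covDeriv₂ K y W X V = (∇_V K)(W, X)`).
Its trace is the momentum constraint `div K − d(tr K) = Ric(ν, df ·)` of general relativity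
(Wald 1984, (10.2.29); Choquet-Bruhat 2009, Ch. VI, (3.11)).

* `codazzi_equation_localFrame` — **the Codazzi equation on a coordinate triple**: for a smooth
  spacelike immersion `f : (N, f^*g) → (M, g)` of a hypersurface (`dim M = dim N + 1`) with a unit
  normal field `ν` of sign `ε ≠ 0` (smooth lift to `TM`), a field `Kc` of continuous bilinear
  forms on `TN` agreeing with `K` and differentiable at `y₀`, and three coordinate fields
  `∂ᵢ, ∂ⱼ, ∂ₖ` of a chart at `y₀`:
  `(∇_{∂ᵢ} K)(∂ⱼ, ∂ₖ) − (∇_{∂ⱼ} K)(∂ᵢ, ∂ₖ) = g(R̄(df ∂ᵢ, df ∂ⱼ) ν, df ∂ₖ)` at `y₀`.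
* `PseudoRiemannianMetric.val_covariantDerivAlong_normal_self_eq_zero` — `g(D(ν ∘ c)/dt, ν) = 0`
  along any curve, for a unit normal field (differentiate `g(ν, ν) = ε`; O'Neill 1983, Ch. 4,
  Lemma 4.19 ff.).

The proof is organised exactly as that of the Gauss equation in `GaussEquationFrame.lean`
(O'Neill's "as usual we can suppose `[V, W] = 0`"): along the coordinate rectangle
`x(t, s) = φ⁻¹(φ y₀ + t eᵢ + s eⱼ)` the field `Z = ν ∘ x` satisfies
`D_t D_s Z − D_s D_t Z = R̄(df ∂ᵢ, df ∂ⱼ) ν`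
(`covariantDerivAlong_covariantDerivAlong_sub_eq_curvature`, O'Neill Prop. 4.44 (2)); pairing
with `df ∂ₖ` and using metric compatibility along the two coordinate lines
(`hasDerivAt_val_apply_along`) gives
`g(D_t D_s ν, df ∂ₖ) = ∂ₜ g(D_s ν, df ∂ₖ) − g(D_s ν, D_t df ∂ₖ)`; here `g(D_s ν, df ∂ₖ) = K(∂ⱼ, ∂ₖ)`
along the `t`-line (`covariantDerivAlong_normal_symm_comp₀`, `secondFundamentalForm_apply_holds`),
whose derivative is the directional derivative `∂ᵢ(K(∂ⱼ, ∂ₖ))` entering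
`(∇_{∂ᵢ}K)(∂ⱼ, ∂ₖ) = ∂ᵢ(K(∂ⱼ, ∂ₖ)) − K(∇_{∂ᵢ}∂ⱼ, ∂ₖ) − K(∂ⱼ, ∇_{∂ᵢ}∂ₖ)` (`covDeriv₂_apply_holds`,
`mvfderiv_apply_localFrame`), and `g(D_s ν, D_t df ∂ₖ) = K(∂ⱼ, ∇_{∂ᵢ}∂ₖ)` by the tangent–normal
decomposition (`val_eq_inducedMetric_add_normal`, the tangential Gauss formula
`val_covariantDerivAlong_mfderiv_localFrame_symm_comp₀`, and `g(D_s ν, ν) = 0`). Antisymmetrising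
in `(i, t) ↔ (j, s)`, the terms `K(∇_{∂ᵢ}∂ⱼ, ∂ₖ)` cancel by torsion-freeness
(`covariantDerivative_localFrame_comm`).

Everything is proved; there are no definitions and no named facts.

## References

* B. O'Neill, *Semi-Riemannian geometry with applications to relativity*, Academic Press 1983,
  Ch. 4: Lemma 1, Cor. 2, Lemma 3, Lemma 4 (pp. 97–101), Prop. 33 (Codazzi equation, p. 115),
  Prop. 44 (p. 123); Ch. 3, Prop. 3.18. [ONeill1983]
* R. M. Wald, *General Relativity*, Chicago 1984, (10.2.24)–(10.2.29). [Wald1984]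
* Y. Choquet-Bruhat, *General Relativity and the Einstein Equations*, OUP 2009, Ch. VI, §3,
  (3.11). [ChoquetBruhat2009]
-/

noncomputable section

open Bundle Set Filter Function Manifold
open scoped Manifold ContDiff Topology

namespace Literature.Geometry.Lorentzian

variable {E : Type*} [NormedAddCommGroup E] [NormedSpace ℝ E] {H : Type*} [TopologicalSpace H]
  {I : ModelWithCorners ℝ E H} {M : Type*} [TopologicalSpace M] [ChartedSpace H M]
  [IsManifold I ∞ M]

/-! ### `g(D ν/dt, ν) = 0` for a unit normal field -/

section UnitNormal

variable [FiniteDimensional ℝ E] [CompleteSpace E]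
  (g : PseudoRiemannianMetric I ∞ E (TangentSpace I : M → Type _)) [g.HasLeviCivita]
  {E' : Type*} [NormedAddCommGroup E'] [NormedSpace ℝ E'] {H' : Type*} [TopologicalSpace H']
  {I' : ModelWithCorners ℝ E' H'} {N : Type*} [TopologicalSpace N] [ChartedSpace H' N]
  {f : N → M} {ν : NormalField I f} {ε : ℝ}

omit [CompleteSpace E] in
/-- **`g(D(ν ∘ c)/dt, ν) = 0` for a unit normal field.** If `g(ν, ν) = ε` identically and the lift
to `TM` of `t ↦ ν (c t)` along the curve `f ∘ c` is differentiable at `0`, then the covariant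
derivative of `ν ∘ c` along `f ∘ c` at `0` is orthogonal to `ν (c 0)`: differentiate the constant
function `t ↦ g(ν (c t), ν (c t))` by the product rule along `f ∘ c` (`hasDerivAt_val_apply_along`,
compatibility of the Levi-Civita connection). O'Neill 1983, Ch. 4, Lemma 4.19 ff. (the shape
operator is tangent-valued). [cite: ONeill1983, Ch. 4, Lemma 4.19] -/
theorem PseudoRiemannianMetric.val_covariantDerivAlong_normal_self_eq_zero
    (hun : g.IsUnitNormal I' f ν ε) (c : ℝ → N)
    (hV : MDifferentiableAt 𝓘(ℝ, ℝ) I.tangent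
      (fun t ↦ (TotalSpace.mk' E (f (c t)) (ν (c t)) : TangentBundle I M)) 0) :
    g.val (f (c 0)) (covariantDerivAlong g.leviCivita (fun t ↦ f (c t)) (fun t ↦ ν (c t)) 0)
      (ν (c 0)) = 0 := by
  have hd := g.hasDerivAt_val_apply_along
    (PseudoRiemannianMetric.isLeviCivita_leviCivita_holds (g := g)).2
    (γ := fun t ↦ f (c t)) (V := fun t ↦ ν (c t)) (W := fun t ↦ ν (c t)) (t₀ := 0) hV hV
  have hconst : (fun t ↦ g.val (f (c t)) (ν (c t)) (ν (c t))) = fun _ ↦ ε :=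
    funext fun t ↦ hun.2 (c t)
  rw [hconst] at hd
  have h0 := hd.unique (hasDerivAt_const 0 ε)
  rw [g.symm (f (c 0)) (ν (c 0))] at h0
  linarith

end UnitNormal

/-! ### The Codazzi equation on a coordinate triple -/

section Codazzi

variable [FiniteDimensional ℝ E] [CompleteSpace E]
  (g : PseudoRiemannianMetric I ∞ E (TangentSpace I : M → Type _)) [g.HasLeviCivita]
  {E' : Type*} [NormedAddCommGroup E'] [NormedSpace ℝ E'] {H' : Type*} [TopologicalSpace H']
  {I' : ModelWithCorners ℝ E' H'} {N : Type*} [TopologicalSpace N] [ChartedSpace H' N]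
  [IsManifold I' ∞ N] [FiniteDimensional ℝ E'] [CompleteSpace E'] [I'.Boundaryless] {f : N → M}
  (hpb : PseudoRiemannianMetric.contMDiff_pullbackBilin I M I' N ∞)
  (hfi : g.IsSpacelikeImmersion I' f) {ν : NormalField I f} {ε : ℝ}
  {ι : Type*} [Fintype ι] [DecidableEq ι] (b' : Module.Basis ι ℝ E') {y₀ : N}

set_option maxHeartbeats 400000 in
/-- **The Codazzi equation on a coordinate triple** (O'Neill 1983, Ch. 4, Prop. 33, p. 115:
`nor R̄_{VW}X = −(∇_V II)(W,X) + (∇_W II)(V,X)`; Lee, *Riemannian Manifolds*, Thm. 8.9). For a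
smooth spacelike immersion `f : (N, f^*g) → (M, g)` of a hypersurface (`dim M = dim N + 1`), a
unit normal field `ν` of sign `ε ≠ 0` along `f` with smooth lift to `TM`, a field `Kc` of
continuous bilinear forms on `TN` which agrees with the second fundamental form
`K = secondFundamentalForm` (`K(v, w) = g(D_v ν, df w)`) and is differentiable at `y₀` as a
section of `Hom(TN, Hom(TN, ℝ))`, and indices `i, j, k` of the coordinate frame `∂ₐ` of the chart
at `y₀` (basis `b'`):
`(∇_{∂ᵢ}K)(∂ⱼ, ∂ₖ)(y₀) − (∇_{∂ⱼ}K)(∂ᵢ, ∂ₖ)(y₀) = g(R̄(df ∂ᵢ, df ∂ⱼ) ν, df ∂ₖ)(f y₀)`,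
with `∇K = covDeriv₂` of the induced metric `f^*g` (derivative slot last) and `R̄ = riemann` of `g`
(convention `R(X,Y) = ∇_X∇_Y − ∇_Y∇_X − ∇_{[X,Y]}`). Proof: see the module docstring.
[cite: ONeill1983, Ch. 4, Prop. 33] -/
theorem codazzi_equation_localFrame
    (hν : ContMDiff I' I.tangent ∞ (fun x ↦ (TotalSpace.mk' E (f x) (ν x) : TangentBundle I M)))
    (hun : g.IsUnitNormal I' f ν ε) (hε : ε ≠ 0)
    (hdim : Module.finrank ℝ E = Module.finrank ℝ E' + 1)
    (Kc : Π y : N, TangentSpace I' y →L[ℝ] TangentSpace I' y →L[ℝ] ℝ)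
    (hKc : ∀ (y : N) (v w : TangentSpace I' y),
      Kc y v w = g.secondFundamentalForm I' f ν y v w)
    (hKd : MDifferentiableAt I' (I'.prod 𝓘(ℝ, E' →L[ℝ] E' →L[ℝ] ℝ))
      (fun y ↦ TotalSpace.mk' (E' →L[ℝ] E' →L[ℝ] ℝ)
        (E := fun y : N ↦ TangentSpace I' y →L[ℝ] TangentSpace I' y →L[ℝ] ℝ) y (Kc y)) y₀)
    (i j k : ι) :
    haveI := (g.inducedMetric f hpb hfi).hasLeviCivita
    (g.inducedMetric f hpb hfi).covDeriv₂ Kc y₀ ((trivializationAt E' (TangentSpace I')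
        y₀).localFrame b' j y₀) ((trivializationAt E' (TangentSpace I') y₀).localFrame b' k y₀)
        ((trivializationAt E' (TangentSpace I') y₀).localFrame b' i y₀) -
        (g.inducedMetric f hpb hfi).covDeriv₂ Kc y₀ ((trivializationAt E' (TangentSpace I')
            y₀).localFrame b' i y₀) ((trivializationAt E' (TangentSpace I') y₀).localFrame b' k y₀)
            ((trivializationAt E' (TangentSpace I') y₀).localFrame b' j y₀) =
      g.val (f y₀) (g.riemann (f y₀) (mfderiv I' I f y₀ ((trivializationAt E' (TangentSpace I')
          y₀).localFrame b' i y₀)) (mfderiv I' I f y₀ ((trivializationAt E' (TangentSpace I')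
          y₀).localFrame b' j y₀))
        (ν y₀)) (mfderiv I' I f y₀ ((trivializationAt E' (TangentSpace I') y₀).localFrame b' k y₀))
            := by
  haveI := (g.inducedMetric f hpb hfi).hasLeviCivita
  -- regularity and bookkeeping
  have hf : ContMDiff I' I ∞ f := PseudoRiemannianMetric.IsSpacelikeImmersion.contMDiff_self hfi
  have hf2 : ContMDiff I' I 2 f := hf.of_le (by exact WithTop.coe_le_coe.2 le_top)
  have hfd : ∀ z, MDifferentiableAt I' I f z := hf2.mdifferentiable two_ne_zero
  have hcovM : g.leviCivita.IsLocallyContMDiff 1 :=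
    g.isLocallyContMDiff_leviCivita_holds 1 (by exact_mod_cast le_top)
  have hcompatM := (PseudoRiemannianMetric.isLeviCivita_leviCivita_holds (g := g)).2
  have htorsN := (PseudoRiemannianMetric.isLeviCivita_leviCivita_holds
    (g := g.inducedMetric f hpb hfi)).1
  have hy₀ : y₀ ∈ (chartAt H' y₀).source := mem_chart_source H' y₀
  have hz : (extChartAt I' y₀) y₀ ∈ (extChartAt I' y₀).target := mem_extChartAt_target y₀
  have hz00 : (extChartAt I' y₀) y₀ + (0 : ℝ) • b' i + (0 : ℝ) • b' j ∈ (extChartAt I' y₀).target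
      := by
    simp only [zero_smul, add_zero]; exact hz
  have hq : (extChartAt I' y₀).symm ((extChartAt I' y₀) y₀ + (0 : ℝ) • b' i + (0 : ℝ) • b' j) = y₀
      := by
    rw [zero_smul, zero_smul, add_zero, add_zero]; exact extChartAt_to_inv y₀
  have hq₁ : (extChartAt I' y₀).symm ((extChartAt I' y₀) y₀ + (0 : ℝ) • b' i + (0 : ℝ) • b' j) ∈
      (chartAt H' y₀).source := by rw [hq]; exact hy₀
  have hq₁e : (extChartAt I' y₀).symm ((extChartAt I' y₀) y₀ + (0 : ℝ) • b' i + (0 : ℝ) • b' j) ∈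
      (trivializationAt E' (TangentSpace I') y₀).baseSet := by
    rw [TangentBundle.trivializationAt_baseSet]; exact hq₁
  have hI'1 : IsManifold I' (1 + 1) N := inferInstanceAs (IsManifold I' 2 N)
  have hVB1 : ContMDiffVectorBundle 1 E' (TangentSpace I' : N → Type _) I' :=
    TangentBundle.contMDiffVectorBundle
  -- the coordinate rectangle and the two-parameter data `Z = ν ∘ x`
  have hx2 : ContMDiffAt (𝓘(ℝ, ℝ).prod 𝓘(ℝ, ℝ)) I' 2
      (uncurry fun t s : ℝ ↦ (extChartAt I' y₀).symm ((extChartAt I' y₀) y₀ + t • b' i + s • b' j))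
          (0, 0) :=
    (contMDiffAt_chartRect hz (b' i) (b' j)).of_le (by exact WithTop.coe_le_coe.2 le_top)
  have hF2 : ContMDiffAt (𝓘(ℝ, ℝ).prod 𝓘(ℝ, ℝ)) I 2
      (uncurry fun t s : ℝ ↦ f ((extChartAt I' y₀).symm ((extChartAt I' y₀) y₀ + t • b' i + s • b'
          j))) (0, 0) := hf2.contMDiffAt.comp (0, 0) hx2
  have hZ2 : ContMDiffAt (𝓘(ℝ, ℝ).prod 𝓘(ℝ, ℝ)) I.tangent 2
      (fun q : ℝ × ℝ ↦ (TotalSpace.mk' E (f ((extChartAt I' y₀).symm ((extChartAt I' y₀) y₀ + q.1 •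
          b' i + q.2 • b' j))) (ν ((extChartAt I' y₀).symm ((extChartAt I' y₀) y₀ + q.1 • b' i +
          q.2 • b' j))) :
        TangentBundle I M)) (0, 0) :=
    (hν.contMDiffAt.of_le (by exact WithTop.coe_le_coe.2 le_top)).comp (0, 0) hx2
  -- (c) `D_t D_s ν − D_s D_t ν = R̄(df ∂ᵢ, df ∂ⱼ) ν`, paired with `df ∂ₖ`
  have hM0 := covariantDerivAlong_covariantDerivAlong_sub_eq_curvature g.leviCivita hcovM
    (x := fun t s : ℝ ↦ f ((extChartAt I' y₀).symm ((extChartAt I' y₀) y₀ + t • b' i + s • b' j)))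
        (Z := fun t s : ℝ ↦ ν ((extChartAt I' y₀).symm ((extChartAt I' y₀) y₀ + t • b' i + s • b'
        j)))
    (t := 0) (s := 0) hF2 hZ2
  have hℓi : HasDerivAt (fun t : ℝ ↦ (extChartAt I' y₀) y₀ + t • b' i + (0 : ℝ) • b' j) (b' i) 0 :=
      by
    simpa using (((hasDerivAt_id (0 : ℝ)).smul_const (b' i)).const_add ((extChartAt I' y₀)
        y₀)).add_const ((0 : ℝ) • b' j)
  have hℓj : HasDerivAt (fun s : ℝ ↦ (extChartAt I' y₀) y₀ + (0 : ℝ) • b' i + s • b' j) (b' j) 0 :=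
      by
    simpa using ((hasDerivAt_id (0 : ℝ)).smul_const (b' j)).const_add ((extChartAt I' y₀) y₀ + (0 :
        ℝ) • b' i)
  rw [velocity_comp_symm_comp₀ b' (ℓ := fun t : ℝ ↦ (extChartAt I' y₀) y₀ + t • b' i + (0 : ℝ) • b'
      j) hz00 hℓi (hfd _),
    velocity_comp_symm_comp₀ b' (ℓ := fun s : ℝ ↦ (extChartAt I' y₀) y₀ + (0 : ℝ) • b' i + s • b'
        j) hz00 hℓj (hfd _),
    sum_coord_basis_smul, sum_coord_basis_smul] at hM0
  have hM := congrArg (fun v ↦ g.val (f ((extChartAt I' y₀).symm ((extChartAt I' y₀) y₀ + (0 : ℝ) •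
      b' i + (0 : ℝ) • b' j))) v
    (mfderiv I' I f ((extChartAt I' y₀).symm ((extChartAt I' y₀) y₀ + (0 : ℝ) • b' i + (0 : ℝ) • b'
        j)) ((trivializationAt E' (TangentSpace I') y₀).localFrame b' k ((extChartAt I' y₀).symm
        ((extChartAt I' y₀) y₀ + (0 : ℝ) • b' i + (0 : ℝ) • b' j))))) hM0
  simp only [map_sub, _root_.sub_apply] at hM
  -- lifts along the parameter curves are differentiable
  have hVlift := mdifferentiableAt_lift_covariantDerivAlong_curry_right g.leviCivita hcovM
    (x := fun t s : ℝ ↦ f ((extChartAt I' y₀).symm ((extChartAt I' y₀) y₀ + t • b' i + s • b' j)))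
        (Z := fun t s : ℝ ↦ ν ((extChartAt I' y₀).symm ((extChartAt I' y₀) y₀ + t • b' i + s • b'
        j)))
    (t := 0) (s := 0) hF2 hZ2
  have hVBlift := mdifferentiableAt_lift_covariantDerivAlong_curry_left g.leviCivita hcovM
    (x := fun t s : ℝ ↦ f ((extChartAt I' y₀).symm ((extChartAt I' y₀) y₀ + t • b' i + s • b' j)))
        (Z := fun t s : ℝ ↦ ν ((extChartAt I' y₀).symm ((extChartAt I' y₀) y₀ + t • b' i + s • b'
        j)))
    (t := 0) (s := 0) hF2 hZ2
  have hci : MDifferentiableAt 𝓘(ℝ, ℝ) I' (fun t : ℝ ↦ (extChartAt I' y₀).symm ((extChartAt I' y₀)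
      y₀ + t • b' i + (0 : ℝ) • b' j)) 0 :=
    mdifferentiableAt_curry_left hx2 two_ne_zero
  have hcj : MDifferentiableAt 𝓘(ℝ, ℝ) I' (fun s : ℝ ↦ (extChartAt I' y₀).symm ((extChartAt I' y₀)
      y₀ + (0 : ℝ) • b' i + s • b' j)) 0 :=
    mdifferentiableAt_curry_right hx2 two_ne_zero
  have hSi1 : ∀ t s : ℝ, ∀ a, MDiffAt (T% ((trivializationAt E' (TangentSpace I') y₀).localFrame b'
      a)) ((fun t s : ℝ ↦ (extChartAt I' y₀).symm ((extChartAt I' y₀) y₀ + t • b' i + s • b' j)) t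
      s) →
      MDifferentiableAt I' I.tangent (fun z ↦ (TotalSpace.mk' E (f z)
        (mfderiv I' I f (z) ((trivializationAt E' (TangentSpace I') y₀).localFrame b' a (z))) :
            TangentBundle I M)) ((fun t s : ℝ ↦ (extChartAt I' y₀).symm ((extChartAt I' y₀) y₀ + t
            • b' i + s • b' j)) t s)
          :=
    fun t s a h ↦ mdifferentiableAt_lift_mfderiv hf2 h
  have hSq : ∀ a, MDiffAt (T% ((trivializationAt E' (TangentSpace I') y₀).localFrame b' a))
      ((extChartAt I' y₀).symm ((extChartAt I' y₀) y₀ + (0 : ℝ) • b' i + (0 : ℝ) • b' j)) := fun a ↦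
    (contMDiffAt_localFrame_of_mem 1 _ b' a hq₁e).mdifferentiableAt one_ne_zero
  have hWlift : MDifferentiableAt 𝓘(ℝ, ℝ) I.tangent (fun t : ℝ ↦ (TotalSpace.mk' E
      (f ((extChartAt I' y₀).symm ((extChartAt I' y₀) y₀ + t • b' i + (0 : ℝ) • b' j))) (mfderiv I'
          I f ((extChartAt I' y₀).symm ((extChartAt I' y₀) y₀ + t • b' i + (0 : ℝ) • b' j))
        ((trivializationAt E' (TangentSpace I') y₀).localFrame b' k ((extChartAt I' y₀).symm
            ((extChartAt I' y₀) y₀ + t • b' i + (0 : ℝ) • b' j)))) : TangentBundle I M)) 0 :=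
    mdifferentiableAt_lift_comp_curve (I := I) (f := f) (c := fun t : ℝ ↦ (extChartAt I' y₀).symm
        ((extChartAt I' y₀) y₀ + t • b' i + (0 : ℝ) • b' j))
      (Y := fun z ↦ mfderiv I' I f (z) ((trivializationAt E' (TangentSpace I') y₀).localFrame b' k
          (z))) hci (hSi1 0 0 k (hSq k))
  have hWBlift : MDifferentiableAt 𝓘(ℝ, ℝ) I.tangent (fun s : ℝ ↦ (TotalSpace.mk' E
      (f ((extChartAt I' y₀).symm ((extChartAt I' y₀) y₀ + (0 : ℝ) • b' i + s • b' j))) (mfderiv I'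
          I f ((extChartAt I' y₀).symm ((extChartAt I' y₀) y₀ + (0 : ℝ) • b' i + s • b' j))
        ((trivializationAt E' (TangentSpace I') y₀).localFrame b' k ((extChartAt I' y₀).symm
            ((extChartAt I' y₀) y₀ + (0 : ℝ) • b' i + s • b' j)))) : TangentBundle I M)) 0 :=
    mdifferentiableAt_lift_comp_curve (I := I) (f := f) (c := fun s : ℝ ↦ (extChartAt I' y₀).symm
        ((extChartAt I' y₀) y₀ + (0 : ℝ) • b' i + s • b' j))
      (Y := fun z ↦ mfderiv I' I f (z) ((trivializationAt E' (TangentSpace I') y₀).localFrame b' k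
          (z))) hcj (hSi1 0 0 k (hSq k))
  -- compatibility along the `t`-line (`V = D_s ν`, `W = df ∂ₖ`) and the `s`-line
  have hA := (g.hasDerivAt_val_apply_along hcompatM (γ := fun t : ℝ ↦ f ((extChartAt I' y₀).symm
      ((extChartAt I' y₀) y₀ + t • b' i + (0 : ℝ) • b' j)))
    (V := fun t : ℝ ↦ covariantDerivAlong g.leviCivita (fun s : ℝ ↦ f ((extChartAt I' y₀).symm
        ((extChartAt I' y₀) y₀ + t • b' i + s • b' j)))
      (fun s ↦ ν ((extChartAt I' y₀).symm ((extChartAt I' y₀) y₀ + t • b' i + s • b' j))) 0)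
    (W := fun t : ℝ ↦ mfderiv I' I f ((extChartAt I' y₀).symm ((extChartAt I' y₀) y₀ + t • b' i +
        (0 : ℝ) • b' j)) ((trivializationAt E' (TangentSpace I') y₀).localFrame b' k ((extChartAt
        I' y₀).symm ((extChartAt I' y₀) y₀ + t • b' i + (0 : ℝ) • b' j))))
    (t₀ := 0) hVlift hWlift).deriv
  have hB := (g.hasDerivAt_val_apply_along hcompatM (γ := fun s : ℝ ↦ f ((extChartAt I' y₀).symm
      ((extChartAt I' y₀) y₀ + (0 : ℝ) • b' i + s • b' j)))
    (V := fun s : ℝ ↦ covariantDerivAlong g.leviCivita (fun t : ℝ ↦ f ((extChartAt I' y₀).symm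
        ((extChartAt I' y₀) y₀ + t • b' i + s • b' j)))
      (fun t ↦ ν ((extChartAt I' y₀).symm ((extChartAt I' y₀) y₀ + t • b' i + s • b' j))) 0)
    (W := fun s : ℝ ↦ mfderiv I' I f ((extChartAt I' y₀).symm ((extChartAt I' y₀) y₀ + (0 : ℝ) • b'
        i + s • b' j)) ((trivializationAt E' (TangentSpace I') y₀).localFrame b' k ((extChartAt I'
        y₀).symm ((extChartAt I' y₀) y₀ + (0 : ℝ) • b' i + s • b' j))))
    (t₀ := 0) hVBlift hWBlift).deriv
  -- (I1), (I2): along the lines the first-order pairings are `K(∂ⱼ, ∂ₖ)`, `K(∂ᵢ, ∂ₖ)`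
  have hmem_i : ∀ᶠ t : ℝ in 𝓝 0, (extChartAt I' y₀) y₀ + t • b' i + (0 : ℝ) • b' j ∈ (extChartAt I'
      y₀).target :=
    hℓi.continuousAt.preimage_mem_nhds ((isOpen_extChartAt_target y₀).mem_nhds hz00)
  have hmem_j : ∀ᶠ s : ℝ in 𝓝 0, (extChartAt I' y₀) y₀ + (0 : ℝ) • b' i + s • b' j ∈ (extChartAt I'
      y₀).target :=
    hℓj.continuousAt.preimage_mem_nhds ((isOpen_extChartAt_target y₀).mem_nhds hz00)
  have haff_s : ∀ t s : ℝ, (extChartAt I' y₀) y₀ + t • b' i + s • b' j = (extChartAt I' y₀) y₀ + t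
      • b' i + (0 : ℝ) • b' j + s • b' j := fun t s ↦ by
    simp only [zero_smul, add_zero]
  have haff_t : ∀ s t : ℝ, (extChartAt I' y₀) y₀ + t • b' i + s • b' j = (extChartAt I' y₀) y₀ + (0
      : ℝ) • b' i + s • b' j + t • b' i := fun s t ↦ by
    simp only [zero_smul, add_zero]; abel
  have hVW : ∀ t : ℝ, (extChartAt I' y₀) y₀ + t • b' i + (0 : ℝ) • b' j ∈ (extChartAt I' y₀).target
      →
      g.val (f ((extChartAt I' y₀).symm ((extChartAt I' y₀) y₀ + t • b' i + (0 : ℝ) • b' j)))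
          (covariantDerivAlong g.leviCivita
        (fun s : ℝ ↦ f ((extChartAt I' y₀).symm ((extChartAt I' y₀) y₀ + t • b' i + s • b' j)))
            (fun s ↦ ν ((extChartAt I' y₀).symm ((extChartAt I' y₀) y₀ + t • b' i + s • b' j))) 0)
        (mfderiv I' I f ((extChartAt I' y₀).symm ((extChartAt I' y₀) y₀ + t • b' i + (0 : ℝ) • b'
            j)) ((trivializationAt E' (TangentSpace I') y₀).localFrame b' k ((extChartAt I'
            y₀).symm ((extChartAt I' y₀) y₀ + t • b' i + (0 : ℝ) • b' j)))) =
      Kc ((extChartAt I' y₀).symm ((extChartAt I' y₀) y₀ + t • b' i + (0 : ℝ) • b' j))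
          ((trivializationAt E' (TangentSpace I') y₀).localFrame b' j ((extChartAt I' y₀).symm
          ((extChartAt I' y₀) y₀ + t • b' i + (0 : ℝ) • b' j))) ((trivializationAt E' (TangentSpace
          I') y₀).localFrame b' k ((extChartAt I' y₀).symm ((extChartAt I' y₀) y₀ + t • b' i + (0 :
          ℝ) • b' j))) := by
    intro t ht
    have hℓ : HasDerivAt (fun s : ℝ ↦ (extChartAt I' y₀) y₀ + t • b' i + s • b' j) (b' j) 0 := by
      simpa using ((hasDerivAt_id (0 : ℝ)).smul_const (b' j)).const_add ((extChartAt I' y₀) y₀ +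
        t • b' i)
    have hℓ0 : (fun s : ℝ ↦ (extChartAt I' y₀) y₀ + t • b' i + s • b' j) 0 ∈ (extChartAt I'
        y₀).target := by
      simpa using ht
    have hνd : MDifferentiableAt I' I.tangent
        (fun x ↦ (TotalSpace.mk' E (f x) (ν x) : TangentBundle I M)) ((extChartAt I' y₀).symm
            ((extChartAt I' y₀) y₀ + t • b' i + (0 : ℝ) • b' j)) :=
      hν.mdifferentiableAt (by simp)
    rw [covariantDerivAlong_normal_symm_comp₀ g b' hℓ0 hℓ hνd, sum_coord_basis_smul, hKc,
      PseudoRiemannianMetric.secondFundamentalForm_apply_holds BoundarylessManifold.isInteriorPoint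
        hνd]
  have hV'W' : ∀ s : ℝ, (extChartAt I' y₀) y₀ + (0 : ℝ) • b' i + s • b' j ∈ (extChartAt I'
      y₀).target →
      g.val (f ((extChartAt I' y₀).symm ((extChartAt I' y₀) y₀ + (0 : ℝ) • b' i + s • b' j)))
          (covariantDerivAlong g.leviCivita
        (fun t : ℝ ↦ f ((extChartAt I' y₀).symm ((extChartAt I' y₀) y₀ + t • b' i + s • b' j)))
            (fun t ↦ ν ((extChartAt I' y₀).symm ((extChartAt I' y₀) y₀ + t • b' i + s • b' j))) 0)
        (mfderiv I' I f ((extChartAt I' y₀).symm ((extChartAt I' y₀) y₀ + (0 : ℝ) • b' i + s • b'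
            j)) ((trivializationAt E' (TangentSpace I') y₀).localFrame b' k ((extChartAt I'
            y₀).symm ((extChartAt I' y₀) y₀ + (0 : ℝ) • b' i + s • b' j)))) =
      Kc ((extChartAt I' y₀).symm ((extChartAt I' y₀) y₀ + (0 : ℝ) • b' i + s • b' j))
          ((trivializationAt E' (TangentSpace I') y₀).localFrame b' i ((extChartAt I' y₀).symm
          ((extChartAt I' y₀) y₀ + (0 : ℝ) • b' i + s • b' j))) ((trivializationAt E' (TangentSpace
          I') y₀).localFrame b' k ((extChartAt I' y₀).symm ((extChartAt I' y₀) y₀ + (0 : ℝ) • b' i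
          + s • b' j))) := by
    intro s hs
    have hℓ : HasDerivAt (fun t : ℝ ↦ (extChartAt I' y₀) y₀ + t • b' i + s • b' j) (b' i) 0 := by
      have h := (((hasDerivAt_id (0 : ℝ)).smul_const (b' i)).const_add ((extChartAt I' y₀)
        y₀)).add_const (s • b' j)
      simpa using h
    have hℓ0 : (fun t : ℝ ↦ (extChartAt I' y₀) y₀ + t • b' i + s • b' j) 0 ∈ (extChartAt I'
        y₀).target := by
      simpa using hs
    have hνd : MDifferentiableAt I' I.tangent
        (fun x ↦ (TotalSpace.mk' E (f x) (ν x) : TangentBundle I M)) ((extChartAt I' y₀).symm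
            ((extChartAt I' y₀) y₀ + (0 : ℝ) • b' i + s • b' j)) :=
      hν.mdifferentiableAt (by simp)
    rw [covariantDerivAlong_normal_symm_comp₀ g b' hℓ0 hℓ hνd, sum_coord_basis_smul, hKc,
      PseudoRiemannianMetric.secondFundamentalForm_apply_holds BoundarylessManifold.isInteriorPoint
        hνd]
  have h1 : deriv (fun t : ℝ ↦ g.val (f ((extChartAt I' y₀).symm ((extChartAt I' y₀) y₀ + t • b' i
      + (0 : ℝ) • b' j))) (covariantDerivAlong g.leviCivita
      (fun s : ℝ ↦ f ((extChartAt I' y₀).symm ((extChartAt I' y₀) y₀ + t • b' i + s • b' j))) (fun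
          s ↦ ν ((extChartAt I' y₀).symm ((extChartAt I' y₀) y₀ + t • b' i + s • b' j))) 0)
      (mfderiv I' I f ((extChartAt I' y₀).symm ((extChartAt I' y₀) y₀ + t • b' i + (0 : ℝ) • b' j))
          ((trivializationAt E' (TangentSpace I') y₀).localFrame b' k ((extChartAt I' y₀).symm
          ((extChartAt I' y₀) y₀ + t • b' i + (0 : ℝ) • b' j))))) 0 =
      deriv (fun t : ℝ ↦ Kc ((extChartAt I' y₀).symm ((extChartAt I' y₀) y₀ + t • b' i + (0 : ℝ) •
          b' j)) ((trivializationAt E' (TangentSpace I') y₀).localFrame b' j ((extChartAt I'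
          y₀).symm ((extChartAt I' y₀) y₀ + t • b' i + (0 : ℝ) • b' j)))
        ((trivializationAt E' (TangentSpace I') y₀).localFrame b' k ((extChartAt I' y₀).symm
            ((extChartAt I' y₀) y₀ + t • b' i + (0 : ℝ) • b' j)))) 0 := by
    refine Filter.EventuallyEq.deriv_eq ?_
    filter_upwards [hmem_i] with t ht
    exact hVW t ht
  have h2 : deriv (fun s : ℝ ↦ g.val (f ((extChartAt I' y₀).symm ((extChartAt I' y₀) y₀ + (0 : ℝ) •
      b' i + s • b' j))) (covariantDerivAlong g.leviCivita
      (fun t : ℝ ↦ f ((extChartAt I' y₀).symm ((extChartAt I' y₀) y₀ + t • b' i + s • b' j))) (fun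
          t ↦ ν ((extChartAt I' y₀).symm ((extChartAt I' y₀) y₀ + t • b' i + s • b' j))) 0)
      (mfderiv I' I f ((extChartAt I' y₀).symm ((extChartAt I' y₀) y₀ + (0 : ℝ) • b' i + s • b' j))
          ((trivializationAt E' (TangentSpace I') y₀).localFrame b' k ((extChartAt I' y₀).symm
          ((extChartAt I' y₀) y₀ + (0 : ℝ) • b' i + s • b' j))))) 0 =
      deriv (fun s : ℝ ↦ Kc ((extChartAt I' y₀).symm ((extChartAt I' y₀) y₀ + (0 : ℝ) • b' i + s •
          b' j)) ((trivializationAt E' (TangentSpace I') y₀).localFrame b' i ((extChartAt I'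
          y₀).symm ((extChartAt I' y₀) y₀ + (0 : ℝ) • b' i + s • b' j)))
        ((trivializationAt E' (TangentSpace I') y₀).localFrame b' k ((extChartAt I' y₀).symm
            ((extChartAt I' y₀) y₀ + (0 : ℝ) • b' i + s • b' j)))) 0 := by
    refine Filter.EventuallyEq.deriv_eq ?_
    filter_upwards [hmem_j] with s hs
    exact hV'W' s hs
  -- (D) the directional derivatives `∂ᵢ(K(∂ⱼ,∂ₖ))`, `∂ⱼ(K(∂ᵢ,∂ₖ))` at the base point
  have hKdP : MDifferentiableAt I' (I'.prod 𝓘(ℝ, E' →L[ℝ] E' →L[ℝ] ℝ))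
      (fun y ↦ TotalSpace.mk' (E' →L[ℝ] E' →L[ℝ] ℝ)
        (E := fun y : N ↦ TangentSpace I' y →L[ℝ] TangentSpace I' y →L[ℝ] ℝ) y (Kc y))
      ((extChartAt I' y₀).symm ((extChartAt I' y₀) y₀ + (0 : ℝ) • b' i + (0 : ℝ) • b' j)) := by
    rw [hq]; exact hKd
  have h1s : ContMDiffAt 𝓘(ℝ, E') I' ∞ (extChartAt I' y₀).symm
      ((extChartAt I' y₀) y₀ + (0 : ℝ) • b' i + (0 : ℝ) • b' j) :=
    (contMDiffOn_extChartAt_symm y₀).contMDiffAt ((isOpen_extChartAt_target y₀).mem_nhds hz00)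
  have hκjk : MDifferentiableAt I' 𝓘(ℝ, ℝ)
      (fun y ↦ Kc y ((trivializationAt E' (TangentSpace I') y₀).localFrame b' j y)
          ((trivializationAt E' (TangentSpace I') y₀).localFrame b' k y)) ((extChartAt I' y₀).symm
          ((extChartAt I' y₀) y₀ + (0 : ℝ) • b' i + (0 : ℝ) • b' j)) :=
    mdifferentiableAt_bilin_apply hKdP (hSq j) (hSq k)
  have hκik : MDifferentiableAt I' 𝓘(ℝ, ℝ)
      (fun y ↦ Kc y ((trivializationAt E' (TangentSpace I') y₀).localFrame b' i y)
          ((trivializationAt E' (TangentSpace I') y₀).localFrame b' k y)) ((extChartAt I' y₀).symm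
          ((extChartAt I' y₀) y₀ + (0 : ℝ) • b' i + (0 : ℝ) • b' j)) :=
    mdifferentiableAt_bilin_apply hKdP (hSq i) (hSq k)
  have hκjkE : DifferentiableAt ℝ ((fun y ↦ Kc y ((trivializationAt E' (TangentSpace I')
      y₀).localFrame b' j y) ((trivializationAt E' (TangentSpace I') y₀).localFrame b' k y)) ∘
      (extChartAt I' y₀).symm)
      ((extChartAt I' y₀) y₀ + (0 : ℝ) • b' i + (0 : ℝ) • b' j) :=
    mdifferentiableAt_iff_differentiableAt.1 (hκjk.comp _ (h1s.mdifferentiableAt (by simp)))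
  have hκikE : DifferentiableAt ℝ ((fun y ↦ Kc y ((trivializationAt E' (TangentSpace I')
      y₀).localFrame b' i y) ((trivializationAt E' (TangentSpace I') y₀).localFrame b' k y)) ∘
      (extChartAt I' y₀).symm)
      ((extChartAt I' y₀) y₀ + (0 : ℝ) • b' i + (0 : ℝ) • b' j) :=
    mdifferentiableAt_iff_differentiableAt.1 (hκik.comp _ (h1s.mdifferentiableAt (by simp)))
  have hDi : deriv (fun t : ℝ ↦ Kc ((extChartAt I' y₀).symm ((extChartAt I' y₀) y₀ + t • b' i + (0
      : ℝ) • b' j)) ((trivializationAt E' (TangentSpace I') y₀).localFrame b' j ((extChartAt I'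
      y₀).symm ((extChartAt I' y₀) y₀ + t • b' i + (0 : ℝ) • b' j)))
        ((trivializationAt E' (TangentSpace I') y₀).localFrame b' k ((extChartAt I' y₀).symm
            ((extChartAt I' y₀) y₀ + t • b' i + (0 : ℝ) • b' j)))) 0 =
      mvfderiv I' (fun y ↦ Kc y ((trivializationAt E' (TangentSpace I') y₀).localFrame b' j y)
          ((trivializationAt E' (TangentSpace I') y₀).localFrame b' k y)) ((extChartAt I' y₀).symm
          ((extChartAt I' y₀) y₀ + (0 : ℝ) • b' i + (0 : ℝ) • b' j))
        ((trivializationAt E' (TangentSpace I') y₀).localFrame b' i ((extChartAt I' y₀).symm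
            ((extChartAt I' y₀) y₀ + (0 : ℝ) • b' i + (0 : ℝ) • b' j))) := by
    rw [mvfderiv_apply_localFrame b' hq₁ hκjk i, (extChartAt I' y₀).right_inv hz00]
    exact (hκjkE.hasFDerivAt.comp_hasDerivAt (0 : ℝ) hℓi).deriv
  have hDj : deriv (fun s : ℝ ↦ Kc ((extChartAt I' y₀).symm ((extChartAt I' y₀) y₀ + (0 : ℝ) • b' i
      + s • b' j)) ((trivializationAt E' (TangentSpace I') y₀).localFrame b' i ((extChartAt I'
      y₀).symm ((extChartAt I' y₀) y₀ + (0 : ℝ) • b' i + s • b' j)))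
        ((trivializationAt E' (TangentSpace I') y₀).localFrame b' k ((extChartAt I' y₀).symm
            ((extChartAt I' y₀) y₀ + (0 : ℝ) • b' i + s • b' j)))) 0 =
      mvfderiv I' (fun y ↦ Kc y ((trivializationAt E' (TangentSpace I') y₀).localFrame b' i y)
          ((trivializationAt E' (TangentSpace I') y₀).localFrame b' k y)) ((extChartAt I' y₀).symm
          ((extChartAt I' y₀) y₀ + (0 : ℝ) • b' i + (0 : ℝ) • b' j))
        ((trivializationAt E' (TangentSpace I') y₀).localFrame b' j ((extChartAt I' y₀).symm
            ((extChartAt I' y₀) y₀ + (0 : ℝ) • b' i + (0 : ℝ) • b' j))) := by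
    rw [mvfderiv_apply_localFrame b' hq₁ hκik j, (extChartAt I' y₀).right_inv hz00]
    exact (hκikE.hasFDerivAt.comp_hasDerivAt (0 : ℝ) hℓj).deriv
  -- the covariant differentials `(∇_{∂ᵢ}K)(∂ⱼ,∂ₖ)`, `(∇_{∂ⱼ}K)(∂ᵢ,∂ₖ)` at the base point
  have hC1 := PseudoRiemannianMetric.covDeriv₂_apply_holds (g := g.inducedMetric f hpb hfi) hKdP
    (hSq j) (hSq k) (hSq i)
  have hC2 := PseudoRiemannianMetric.covDeriv₂_apply_holds (g := g.inducedMetric f hpb hfi) hKdP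
    (hSq i) (hSq k) (hSq j)
  simp only [PseudoRiemannianMetric.covDeriv₂Aux] at hC1 hC2
  -- torsion-freeness on the coordinate frame: `∇_{∂ᵢ}∂ⱼ = ∇_{∂ⱼ}∂ᵢ`
  have hcomm : (g.inducedMetric f hpb hfi).leviCivita ((trivializationAt E' (TangentSpace I')
      y₀).localFrame b' j) ((extChartAt I' y₀).symm ((extChartAt I' y₀) y₀ + (0 : ℝ) • b' i + (0 :
      ℝ) • b' j))
        ((trivializationAt E' (TangentSpace I') y₀).localFrame b' i ((extChartAt I' y₀).symm
            ((extChartAt I' y₀) y₀ + (0 : ℝ) • b' i + (0 : ℝ) • b' j))) =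
      (g.inducedMetric f hpb hfi).leviCivita ((trivializationAt E' (TangentSpace I') y₀).localFrame
          b' i) ((extChartAt I' y₀).symm ((extChartAt I' y₀) y₀ + (0 : ℝ) • b' i + (0 : ℝ) • b' j))
        ((trivializationAt E' (TangentSpace I') y₀).localFrame b' j ((extChartAt I' y₀).symm
            ((extChartAt I' y₀) y₀ + (0 : ℝ) • b' i + (0 : ℝ) • b' j))) := by
    rw [hq]
    exact covariantDerivative_localFrame_comm (g.inducedMetric f hpb hfi).leviCivita htorsN b' y₀ i
        j
  -- (E) the cross terms `g(D_s ν, D_t df ∂ₖ) = K(∂ⱼ, ∇_{∂ᵢ}∂ₖ)`,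
  -- `g(D_t ν, D_s df ∂ₖ) = K(∂ᵢ, ∇_{∂ⱼ}∂ₖ)`
  have hνdP : MDifferentiableAt I' I.tangent
      (fun x ↦ (TotalSpace.mk' E (f x) (ν x) : TangentBundle I M)) ((extChartAt I' y₀).symm
          ((extChartAt I' y₀) y₀ + (0 : ℝ) • b' i + (0 : ℝ) • b' j)) :=
    hν.mdifferentiableAt (by simp)
  have hV0 : covariantDerivAlong g.leviCivita (fun s : ℝ ↦ f ((extChartAt I' y₀).symm ((extChartAt
      I' y₀) y₀ + (0 : ℝ) • b' i + s • b' j)))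
        (fun s ↦ ν ((extChartAt I' y₀).symm ((extChartAt I' y₀) y₀ + (0 : ℝ) • b' i + s • b' j))) 0
            =
      g.normalDerivAlong f ν ((extChartAt I' y₀).symm ((extChartAt I' y₀) y₀ + (0 : ℝ) • b' i + (0
          : ℝ) • b' j)) ((trivializationAt E' (TangentSpace I') y₀).localFrame b' j ((extChartAt I'
          y₀).symm ((extChartAt I' y₀) y₀ + (0 : ℝ) • b' i + (0 : ℝ) • b' j))) := by
    rw [covariantDerivAlong_normal_symm_comp₀ g b' (ℓ := fun s : ℝ ↦ (extChartAt I' y₀) y₀ + (0 :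
      ℝ) • b' i + s • b' j) hz00 hℓj hνdP, sum_coord_basis_smul]
  have hV'0 : covariantDerivAlong g.leviCivita (fun t : ℝ ↦ f ((extChartAt I' y₀).symm ((extChartAt
      I' y₀) y₀ + t • b' i + (0 : ℝ) • b' j)))
        (fun t ↦ ν ((extChartAt I' y₀).symm ((extChartAt I' y₀) y₀ + t • b' i + (0 : ℝ) • b' j))) 0
            =
      g.normalDerivAlong f ν ((extChartAt I' y₀).symm ((extChartAt I' y₀) y₀ + (0 : ℝ) • b' i + (0
          : ℝ) • b' j)) ((trivializationAt E' (TangentSpace I') y₀).localFrame b' i ((extChartAt I'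
          y₀).symm ((extChartAt I' y₀) y₀ + (0 : ℝ) • b' i + (0 : ℝ) • b' j))) := by
    rw [covariantDerivAlong_normal_symm_comp₀ g b' (ℓ := fun t : ℝ ↦ (extChartAt I' y₀) y₀ + t •
      b' i + (0 : ℝ) • b' j) hz00 hℓi hνdP, sum_coord_basis_smul]
  have hVν : g.val (f ((extChartAt I' y₀).symm ((extChartAt I' y₀) y₀ + (0 : ℝ) • b' i + (0 : ℝ) •
      b' j)))
      (g.normalDerivAlong f ν ((extChartAt I' y₀).symm ((extChartAt I' y₀) y₀ + (0 : ℝ) • b' i + (0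
          : ℝ) • b' j)) ((trivializationAt E' (TangentSpace I') y₀).localFrame b' j ((extChartAt I'
          y₀).symm ((extChartAt I' y₀) y₀ + (0 : ℝ) • b' i + (0 : ℝ) • b' j))))
      (ν ((extChartAt I' y₀).symm ((extChartAt I' y₀) y₀ + (0 : ℝ) • b' i + (0 : ℝ) • b' j))) = 0
          := by
    have h := g.val_covariantDerivAlong_normal_self_eq_zero hun (c := fun s : ℝ ↦ (extChartAt I'
        y₀).symm ((extChartAt I' y₀) y₀ + (0 : ℝ) • b' i + s • b' j))
        (mdifferentiableAt_lift_comp_curve (I := I) hcj hνdP)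
    rwa [hV0] at h
  have hV'ν : g.val (f ((extChartAt I' y₀).symm ((extChartAt I' y₀) y₀ + (0 : ℝ) • b' i + (0 : ℝ) •
      b' j)))
      (g.normalDerivAlong f ν ((extChartAt I' y₀).symm ((extChartAt I' y₀) y₀ + (0 : ℝ) • b' i + (0
          : ℝ) • b' j)) ((trivializationAt E' (TangentSpace I') y₀).localFrame b' i ((extChartAt I'
          y₀).symm ((extChartAt I' y₀) y₀ + (0 : ℝ) • b' i + (0 : ℝ) • b' j))))
      (ν ((extChartAt I' y₀).symm ((extChartAt I' y₀) y₀ + (0 : ℝ) • b' i + (0 : ℝ) • b' j))) = 0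
          := by
    have h := g.val_covariantDerivAlong_normal_self_eq_zero hun (c := fun t : ℝ ↦ (extChartAt I'
        y₀).symm ((extChartAt I' y₀) y₀ + t • b' i + (0 : ℝ) • b' j))
        (mdifferentiableAt_lift_comp_curve (I := I) hci hνdP)
    rwa [hV'0] at h
  have hν0 : ∀ u : TangentSpace I' ((extChartAt I' y₀).symm ((extChartAt I' y₀) y₀ + (0 : ℝ) • b' i
      + (0 : ℝ) • b' j)), g.val (f ((extChartAt I' y₀).symm ((extChartAt I' y₀) y₀ + (0 : ℝ) • b' i
      + (0 : ℝ) • b' j))) (ν ((extChartAt I' y₀).symm ((extChartAt I' y₀) y₀ + (0 : ℝ) • b' i + (0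
      : ℝ) • b' j))) (mfderiv I' I f ((extChartAt I' y₀).symm ((extChartAt I' y₀) y₀ + (0 : ℝ) • b'
      i + (0 : ℝ) • b' j)) (u)) = 0 :=
    fun u ↦ hun.1 _ u
  have hνε : g.val (f ((extChartAt I' y₀).symm ((extChartAt I' y₀) y₀ + (0 : ℝ) • b' i + (0 : ℝ) •
      b' j))) (ν ((extChartAt I' y₀).symm ((extChartAt I' y₀) y₀ + (0 : ℝ) • b' i + (0 : ℝ) • b'
      j)))
      (ν ((extChartAt I' y₀).symm ((extChartAt I' y₀) y₀ + (0 : ℝ) • b' i + (0 : ℝ) • b' j))) = ε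
          := hun.2 _
  -- tangential representatives: `D_t df ∂ₖ ↦ ∇_{∂ᵢ}∂ₖ`, `D_s df ∂ₖ ↦ ∇_{∂ⱼ}∂ₖ`, `D ν ↦ ♯K`
  have t1 := fun u ↦ val_covariantDerivAlong_mfderiv_localFrame_symm_comp₀ g hpb hfi b'
    (ℓ := fun t : ℝ ↦ (extChartAt I' y₀) y₀ + t • b' i + (0 : ℝ) • b' j) hz00 (haff_t 0) k u
  have t2 := fun u ↦ val_covariantDerivAlong_mfderiv_localFrame_symm_comp₀ g hpb hfi b'
    (ℓ := fun s : ℝ ↦ (extChartAt I' y₀) y₀ + (0 : ℝ) • b' i + s • b' j) hz00 (haff_s 0) k u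
  have hbi : covariantDerivAlong (g.inducedMetric f hpb hfi).leviCivita
        (fun t : ℝ ↦ (extChartAt I' y₀).symm ((extChartAt I' y₀) y₀ + t • b' i + (0 : ℝ) • b' j))
            (fun t ↦ (trivializationAt E' (TangentSpace I') y₀).localFrame b' k ((extChartAt I'
            y₀).symm ((extChartAt I' y₀) y₀ + t • b' i + (0 : ℝ) • b' j))) 0 =
      (g.inducedMetric f hpb hfi).leviCivita ((trivializationAt E' (TangentSpace I') y₀).localFrame
          b' k) ((extChartAt I' y₀).symm ((extChartAt I' y₀) y₀ + (0 : ℝ) • b' i + (0 : ℝ) • b' j))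
        ((trivializationAt E' (TangentSpace I') y₀).localFrame b' i ((extChartAt I' y₀).symm
            ((extChartAt I' y₀) y₀ + (0 : ℝ) • b' i + (0 : ℝ) • b' j))) := by
    rw [covariantDerivAlong_localFrame_symm_comp₀ b' (g.inducedMetric f hpb hfi).leviCivita hz00
      hℓi k, sum_coord_basis_smul]
  have hbj : covariantDerivAlong (g.inducedMetric f hpb hfi).leviCivita
        (fun s : ℝ ↦ (extChartAt I' y₀).symm ((extChartAt I' y₀) y₀ + (0 : ℝ) • b' i + s • b' j))
            (fun s ↦ (trivializationAt E' (TangentSpace I') y₀).localFrame b' k ((extChartAt I'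
            y₀).symm ((extChartAt I' y₀) y₀ + (0 : ℝ) • b' i + s • b' j))) 0 =
      (g.inducedMetric f hpb hfi).leviCivita ((trivializationAt E' (TangentSpace I') y₀).localFrame
          b' k) ((extChartAt I' y₀).symm ((extChartAt I' y₀) y₀ + (0 : ℝ) • b' i + (0 : ℝ) • b' j))
        ((trivializationAt E' (TangentSpace I') y₀).localFrame b' j ((extChartAt I' y₀).symm
            ((extChartAt I' y₀) y₀ + (0 : ℝ) • b' i + (0 : ℝ) • b' j))) := by
    rw [covariantDerivAlong_localFrame_symm_comp₀ b' (g.inducedMetric f hpb hfi).leviCivita hz00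
      hℓj k, sum_coord_basis_smul]
  have haj : ∀ u : TangentSpace I' ((extChartAt I' y₀).symm ((extChartAt I' y₀) y₀ + (0 : ℝ) • b' i
      + (0 : ℝ) • b' j)),
      g.val (f ((extChartAt I' y₀).symm ((extChartAt I' y₀) y₀ + (0 : ℝ) • b' i + (0 : ℝ) • b' j)))
        (g.normalDerivAlong f ν ((extChartAt I' y₀).symm ((extChartAt I' y₀) y₀ + (0 : ℝ) • b' i +
            (0 : ℝ) • b' j)) ((trivializationAt E' (TangentSpace I') y₀).localFrame b' j
            ((extChartAt I' y₀).symm ((extChartAt I' y₀) y₀ + (0 : ℝ) • b' i + (0 : ℝ) • b' j))))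
        (mfderiv I' I f ((extChartAt I' y₀).symm ((extChartAt I' y₀) y₀ + (0 : ℝ) • b' i + (0 : ℝ)
            • b' j)) u) =
      (g.inducedMetric f hpb hfi).val ((extChartAt I' y₀).symm ((extChartAt I' y₀) y₀ + (0 : ℝ) •
          b' i + (0 : ℝ) • b' j))
        ((g.inducedMetric f hpb hfi).sharp ((extChartAt I' y₀).symm ((extChartAt I' y₀) y₀ + (0 :
            ℝ) • b' i + (0 : ℝ) • b' j))
          (g.secondFundamentalForm I' f ν ((extChartAt I' y₀).symm ((extChartAt I' y₀) y₀ + (0 : ℝ)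
              • b' i + (0 : ℝ) • b' j))
            ((trivializationAt E' (TangentSpace I') y₀).localFrame b' j ((extChartAt I' y₀).symm
                ((extChartAt I' y₀) y₀ + (0 : ℝ) • b' i + (0 : ℝ) • b' j))))) u := fun u ↦ by
    rw [PseudoRiemannianMetric.val_sharp_apply,
      PseudoRiemannianMetric.secondFundamentalForm_apply_holds BoundarylessManifold.isInteriorPoint
        hνdP]
  have hai : ∀ u : TangentSpace I' ((extChartAt I' y₀).symm ((extChartAt I' y₀) y₀ + (0 : ℝ) • b' i
      + (0 : ℝ) • b' j)),
      g.val (f ((extChartAt I' y₀).symm ((extChartAt I' y₀) y₀ + (0 : ℝ) • b' i + (0 : ℝ) • b' j)))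
        (g.normalDerivAlong f ν ((extChartAt I' y₀).symm ((extChartAt I' y₀) y₀ + (0 : ℝ) • b' i +
            (0 : ℝ) • b' j)) ((trivializationAt E' (TangentSpace I') y₀).localFrame b' i
            ((extChartAt I' y₀).symm ((extChartAt I' y₀) y₀ + (0 : ℝ) • b' i + (0 : ℝ) • b' j))))
        (mfderiv I' I f ((extChartAt I' y₀).symm ((extChartAt I' y₀) y₀ + (0 : ℝ) • b' i + (0 : ℝ)
            • b' j)) u) =
      (g.inducedMetric f hpb hfi).val ((extChartAt I' y₀).symm ((extChartAt I' y₀) y₀ + (0 : ℝ) •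
          b' i + (0 : ℝ) • b' j))
        ((g.inducedMetric f hpb hfi).sharp ((extChartAt I' y₀).symm ((extChartAt I' y₀) y₀ + (0 :
            ℝ) • b' i + (0 : ℝ) • b' j))
          (g.secondFundamentalForm I' f ν ((extChartAt I' y₀).symm ((extChartAt I' y₀) y₀ + (0 : ℝ)
              • b' i + (0 : ℝ) • b' j))
            ((trivializationAt E' (TangentSpace I') y₀).localFrame b' i ((extChartAt I' y₀).symm
                ((extChartAt I' y₀) y₀ + (0 : ℝ) • b' i + (0 : ℝ) • b' j))))) u := fun u ↦ by
    rw [PseudoRiemannianMetric.val_sharp_apply,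
      PseudoRiemannianMetric.secondFundamentalForm_apply_holds BoundarylessManifold.isInteriorPoint
        hνdP]
  have hP1 := val_eq_inducedMetric_add_normal g hpb hfi hν0 hνε hε hdim haj t1
  have hP2 := val_eq_inducedMetric_add_normal g hpb hfi hν0 hνε hε hdim hai t2
  rw [hVν, zero_mul, zero_div, add_zero, PseudoRiemannianMetric.val_sharp_apply, hbi, ← hKc]
    at hP1
  rw [hV'ν, zero_mul, zero_div, add_zero, PseudoRiemannianMetric.val_sharp_apply, hbj, ← hKc]
    at hP2
  rw [hV0] at hA
  rw [hV'0] at hB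
  -- assemble
  have hcommK : Kc ((extChartAt I' y₀).symm ((extChartAt I' y₀) y₀ + (0 : ℝ) • b' i + (0 : ℝ) • b'
      j)) ((g.inducedMetric f hpb hfi).leviCivita ((trivializationAt E' (TangentSpace I')
      y₀).localFrame b' j)
        ((extChartAt I' y₀).symm ((extChartAt I' y₀) y₀ + (0 : ℝ) • b' i + (0 : ℝ) • b' j))
            ((trivializationAt E' (TangentSpace I') y₀).localFrame b' i ((extChartAt I' y₀).symm
            ((extChartAt I' y₀) y₀ + (0 : ℝ) • b' i + (0 : ℝ) • b' j))))
        ((trivializationAt E' (TangentSpace I') y₀).localFrame b' k ((extChartAt I' y₀).symm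
            ((extChartAt I' y₀) y₀ + (0 : ℝ) • b' i + (0 : ℝ) • b' j))) =
      Kc ((extChartAt I' y₀).symm ((extChartAt I' y₀) y₀ + (0 : ℝ) • b' i + (0 : ℝ) • b' j))
          ((g.inducedMetric f hpb hfi).leviCivita ((trivializationAt E' (TangentSpace I')
          y₀).localFrame b' i)
        ((extChartAt I' y₀).symm ((extChartAt I' y₀) y₀ + (0 : ℝ) • b' i + (0 : ℝ) • b' j))
            ((trivializationAt E' (TangentSpace I') y₀).localFrame b' j ((extChartAt I' y₀).symm
            ((extChartAt I' y₀) y₀ + (0 : ℝ) • b' i + (0 : ℝ) • b' j))))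
        ((trivializationAt E' (TangentSpace I') y₀).localFrame b' k ((extChartAt I' y₀).symm
            ((extChartAt I' y₀) y₀ + (0 : ℝ) • b' i + (0 : ℝ) • b' j))) := by
    rw [hcomm]
  have key : (g.inducedMetric f hpb hfi).covDeriv₂ Kc ((extChartAt I' y₀).symm ((extChartAt I' y₀)
      y₀ + (0 : ℝ) • b' i + (0 : ℝ) • b' j))
        ((trivializationAt E' (TangentSpace I') y₀).localFrame b' j ((extChartAt I' y₀).symm
            ((extChartAt I' y₀) y₀ + (0 : ℝ) • b' i + (0 : ℝ) • b' j))) ((trivializationAt E'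
            (TangentSpace I') y₀).localFrame b' k ((extChartAt I' y₀).symm ((extChartAt I' y₀) y₀ +
            (0 : ℝ) • b' i + (0 : ℝ) • b' j)))
        ((trivializationAt E' (TangentSpace I') y₀).localFrame b' i ((extChartAt I' y₀).symm
            ((extChartAt I' y₀) y₀ + (0 : ℝ) • b' i + (0 : ℝ) • b' j))) -
      (g.inducedMetric f hpb hfi).covDeriv₂ Kc ((extChartAt I' y₀).symm ((extChartAt I' y₀) y₀ + (0
          : ℝ) • b' i + (0 : ℝ) • b' j))
        ((trivializationAt E' (TangentSpace I') y₀).localFrame b' i ((extChartAt I' y₀).symm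
            ((extChartAt I' y₀) y₀ + (0 : ℝ) • b' i + (0 : ℝ) • b' j))) ((trivializationAt E'
            (TangentSpace I') y₀).localFrame b' k ((extChartAt I' y₀).symm ((extChartAt I' y₀) y₀ +
            (0 : ℝ) • b' i + (0 : ℝ) • b' j)))
        ((trivializationAt E' (TangentSpace I') y₀).localFrame b' j ((extChartAt I' y₀).symm
            ((extChartAt I' y₀) y₀ + (0 : ℝ) • b' i + (0 : ℝ) • b' j))) =
      g.val (f ((extChartAt I' y₀).symm ((extChartAt I' y₀) y₀ + (0 : ℝ) • b' i + (0 : ℝ) • b' j)))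
          (g.leviCivita.curvature (f ((extChartAt I' y₀).symm ((extChartAt I' y₀) y₀ + (0 : ℝ) • b'
          i + (0 : ℝ) • b' j))) (mfderiv I' I f ((extChartAt I' y₀).symm ((extChartAt I' y₀) y₀ +
          (0 : ℝ) • b' i + (0 : ℝ) • b' j)) ((trivializationAt E' (TangentSpace I') y₀).localFrame
          b' i ((extChartAt I' y₀).symm ((extChartAt I' y₀) y₀ + (0 : ℝ) • b' i + (0 : ℝ) • b' j))))
        (mfderiv I' I f ((extChartAt I' y₀).symm ((extChartAt I' y₀) y₀ + (0 : ℝ) • b' i + (0 : ℝ)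
            • b' j)) ((trivializationAt E' (TangentSpace I') y₀).localFrame b' j ((extChartAt I'
            y₀).symm ((extChartAt I' y₀) y₀ + (0 : ℝ) • b' i + (0 : ℝ) • b' j))))
        (ν ((extChartAt I' y₀).symm ((extChartAt I' y₀) y₀ + (0 : ℝ) • b' i + (0 : ℝ) • b' j))))
            (mfderiv I' I f ((extChartAt I' y₀).symm ((extChartAt I' y₀) y₀ + (0 : ℝ) • b' i + (0 :
            ℝ) • b' j))
        ((trivializationAt E' (TangentSpace I') y₀).localFrame b' k ((extChartAt I' y₀).symm
            ((extChartAt I' y₀) y₀ + (0 : ℝ) • b' i + (0 : ℝ) • b' j)))) := by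
    linear_combination hC1 - hC2 - hcommK + hM + hP1 + hA - h1 - hDi - hP2 - hB + h2 + hDj
  rw [hq] at key
  exact key

end Codazzi

end Literature.Geometry.Lorentzian

end
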